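import Summits.AtomisticToContinuum.HydrodynamicLimit.Theorems.JParityClosureEvenStressEnskogVelocityTruncationOfTails
import Summits.AtomisticToContinuum.HydrodynamicLimit.Theorems.JParityClosureEvenStressEnskogVelocityTailCollisionSumRung0
import Summits.AtomisticToContinuum.HydrodynamicLimit.Theorems.JParityClosureOddContactSymmetryGibbsInvariance
import HarnessLib

/-!
# S1 at rung 0: velocity truncation of the even collision statistic under the homogeneous Gibbs law
# (`stub_velocityTruncationRung0`, line `even-rung-mean-variance`, crux `JParityClosure.EvenStressEnskog`,
# stmt-AtomisticToContinuum-13079)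

The registered stub S1 (`stub_velocityTruncation`) RESTRICTED TO CONSTANT PROFILES `(a, u, θ)`, `a, θ > 0`
(local Gibbs law = the homogeneous Gibbs law `localGibbsLaw σ (fun _ => a) (fun _ => u) (fun _ => θ) N Φ`):
the crux statistic `D(Ξ) = evenStat …` changes little in probability when the unbounded momentum-transfer mark
`Ξ_P^{kl} = evenMark k l` is replaced by its truncation `Ξ_L^{kl} = evenMarkTrunc k l L` (`L → ∞` after
`N → ∞`).  It is the composition of three rung-0 pieces of the line:

* the reduction `velocityTruncation_of_tails_at` (S1 ⇐ collision speed tail ∧ energy tail, profile by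
  profile; `JParityClosureEvenStressEnskogVelocityTruncationOfTails`), with the band `exists_contactValue_bound`
  of the contact value;
* **(H_K)₀** `stub_velocityTailCollisionSumRung0` — the collision sum of the speed-tail mark under the Gibbs law is
  small in probability (Palm / collision-flux upper bound times a Gaussian tail;
  `JParityClosureEvenStressEnskogVelocityTailCollisionSumRung0`);
* **(H_E)₀** — the fixed-time energy tail under the Gibbs law is the static Gaussian tail: Gibbs invariance
  (`Theorems.map_flow_localGibbsLaw_const`) plus the disintegration into i.i.d. Gaussian velocities
  (`lintegral_localGibbsMeasure`) give `∫ T_L(Φ_s z) dG_N = gaussVelTail u θ L → 0` for every flow, time and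
  particle number (private copies `rung0_lintegral_tailEnergy_flow_eq/le`, `rung0_velocityTailEnergy` of the
  lemmas of `JParityClosureEvenStressEnskogVelocityTailEnergyRung0`, kept private here so that this file does not
  wait on that module).

`η₀ = min ηK ηY` is uniform in the profile (`ηK` from (H_K)₀, `ηY` the band of the contact value).

References: H. Spohn, *Large Scale Dynamics of Interacting Particles* (1991), Part I §2.3, §3.
-/

noncomputable section

open MeasureTheory Set Filter Topology
open scoped ENNReal InnerProductSpace BigOperators

namespace Summit.AtomisticToContinuum.HydrodynamicLimit.Theorems.EvenStressEnskog

open Literature.Analysis.FluidPDE Literature.MathematicalPhysics.KineticTheory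

/-! ## (H_E)₀: the fixed-time energy tail under the homogeneous Gibbs law (private copies) -/

/-- **Rung 0 · the fixed-time energy tail under the homogeneous Gibbs law is the static Gaussian
tail.**  For constant profiles `(a, u, θ)` with `θ > 0`, every reduced diameter `σ ≤ 1/2` (so that the
law is a probability measure), EVERY hard-sphere flow, time, truncation level and particle number:
`∫ T_L(Φ_s z) dG_N(z) = t(u, θ, L)` — invariance of the Gibbs law (`map_flow_localGibbsLaw_const`),
disintegration into positions and i.i.d. Gaussian velocities (`lintegral_localGibbsMeasure`), and
`∫ (N+1)⁻¹ Σᵢ t_L(vᵢ) ⊗N(u,θ) = t(u, θ, L)`. [folklore] -/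
private theorem rung0_lintegral_tailEnergy_flow_eq (a : ℝ) (u : V3) {θ : ℝ} (ha : 0 < a) (hθ : 0 < θ) {σ : ℝ}
    (hσ : σ ≤ 1 / 2) (N : ℕ) (Φ : HardSphereFlow (Torus.geometry (Fin 3)) (hsDiameter σ N) (N + 1))
    (s L : ℝ) :
    ∫⁻ z, ENNReal.ofReal (tailEnergy L (Φ.flow s z))
        ∂(localGibbsLaw σ (fun _ => a) (fun _ => u) (fun _ => θ) N Φ) = gaussVelTail u θ L := by
  have hmeas : Measurable fun z : Config (N + 1) (Fin 3) T3 => ENNReal.ofReal (tailEnergy L z) :=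
    (measurable_tailEnergy L).ennreal_ofReal
  -- invariance of the Gibbs law
  have h1 : ∫⁻ z, ENNReal.ofReal (tailEnergy L (Φ.flow s z))
      ∂(localGibbsLaw σ (fun _ => a) (fun _ => u) (fun _ => θ) N Φ) =
      ∫⁻ z, ENNReal.ofReal (tailEnergy L z) ∂(localGibbsLaw σ (fun _ => a) (fun _ => u) (fun _ => θ) N Φ) := by
    rw [← lintegral_map hmeas (Φ.measurable_flow s), map_flow_localGibbsLaw_const]
  rw [h1, localGibbsLaw_eq]
  haveI := isProbabilityMeasure_localGibbsMeasure (a₀ := fun _ => a) (θ₀ := fun _ => θ) (u₀ := fun _ => u)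
    continuous_const continuous_const continuous_const (fun _ => ha) (fun _ => hθ) hσ N
  rw [lintegral_localGibbsMeasure continuous_const continuous_const continuous_const
    (fun _ => ha.le) (fun _ => hθ) σ N hmeas]
  -- the velocity integral, for fixed positions
  have hn0 : ((N + 1 : ℕ) : ℝ≥0∞) ≠ 0 := by exact_mod_cast Nat.succ_ne_zero N
  have hnt : ((N + 1 : ℕ) : ℝ≥0∞) ≠ ∞ := ENNReal.natCast_ne_top _
  have hinner : ∀ x : Fin (N + 1) → T3,
      ∫⁻ v, ENNReal.ofReal (tailEnergy L (zipConfig (x, v))) ∂velMeasure (fun _ => u) (fun _ => θ) x =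
        gaussVelTail u θ L := by
    intro x
    have hpt : ∀ v : Fin (N + 1) → V3, ENNReal.ofReal (tailEnergy L (zipConfig (x, v))) =
        ((N + 1 : ℕ) : ℝ≥0∞)⁻¹ * ∑ i, ENNReal.ofReal (velTail L (v i)) := by
      intro v
      unfold tailEnergy
      simp only [zipConfig_apply]
      rw [ENNReal.ofReal_mul (inv_nonneg.2 (Nat.cast_nonneg _)),
        ENNReal.ofReal_inv_of_pos (by exact_mod_cast Nat.succ_pos N), ENNReal.ofReal_natCast,
        ENNReal.ofReal_sum_of_nonneg fun i _ => velTail_nonneg L _]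
    simp_rw [hpt]
    have hmi : ∀ i : Fin (N + 1), Measurable fun v : Fin (N + 1) → V3 => ENNReal.ofReal (velTail L (v i)) :=
      fun i => ((measurable_velTail L).comp (measurable_pi_apply i)).ennreal_ofReal
    rw [lintegral_const_mul _ (Finset.measurable_sum _ fun i _ => hmi i),
      lintegral_finsetSum _ fun i _ => hmi i]
    have hterm : ∀ i : Fin (N + 1),
        ∫⁻ v, ENNReal.ofReal (velTail L (v i)) ∂velMeasure (fun _ => u) (fun _ => θ) x = gaussVelTail u θ L := by
      intro i
      unfold velMeasure gaussVelTail
      exact (measurePreserving_eval (fun j : Fin (N + 1) => gaussMeasure ((fun _ => u) (x j))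
        ((fun _ => θ) (x j))) i).lintegral_comp (measurable_velTail L).ennreal_ofReal
    simp_rw [hterm]
    rw [Finset.sum_const, Finset.card_univ, Fintype.card_fin, nsmul_eq_mul, ← mul_assoc,
      ENNReal.inv_mul_cancel hn0 hnt, one_mul]
  simp_rw [hinner]
  have hρm : Measurable fun x : Fin (N + 1) → T3 => ENNReal.ofReal
      ((canonicalPartition (Torus.geometry (Fin 3)) (hsDiameter σ N) (N + 1)
        (localGibbsProfile (fun _ => a) (fun _ => u) fun _ => θ))⁻¹ *
          posWeight (fun _ => a) (hsDiameter σ N) (N + 1) x) :=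
    (measurable_const.mul (measurable_posWeight continuous_const _ _)).ennreal_ofReal
  rw [lintegral_mul_const _ hρm,
    lintegral_posWeight_eq_one continuous_const continuous_const continuous_const (fun _ => ha.le)
      (fun _ => hθ) σ N, one_mul]

/-- **Rung 0 of (H_E), uniformly in the flow, the time and the particle number.**  For constant
profiles `(a, u, θ)`, `a, θ > 0`, `σ ≤ 1/2` and `η > 0` there is `L₀` such that for all `L ≥ L₀`, all `N`,
all flows and all times: `∫ T_L(Φ_s z) dG_N(z) ≤ η`. [folklore] -/
private theorem rung0_lintegral_tailEnergy_flow_le (a : ℝ) (u : V3) {θ : ℝ} (ha : 0 < a) (hθ : 0 < θ) {σ : ℝ}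
    (hσ : σ ≤ 1 / 2) {η : ℝ} (hη : 0 < η) :
    ∃ L₀ : ℝ, ∀ L : ℝ, L₀ ≤ L → ∀ (N : ℕ)
      (Φ : HardSphereFlow (Torus.geometry (Fin 3)) (hsDiameter σ N) (N + 1)) (s : ℝ),
      ∫⁻ z, ENNReal.ofReal (tailEnergy L (Φ.flow s z))
        ∂(localGibbsLaw σ (fun _ => a) (fun _ => u) (fun _ => θ) N Φ) ≤ ENNReal.ofReal η := by
  have hη' : (0 : ℝ≥0∞) < ENNReal.ofReal η := ENNReal.ofReal_pos.2 hη
  obtain ⟨L₀, hL₀⟩ := eventually_atTop.1 ((tendsto_gaussVelTail u θ).eventually (gt_mem_nhds hη'))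
  refine ⟨L₀, fun L hL N Φ s => ?_⟩
  rw [rung0_lintegral_tailEnergy_flow_eq a u ha hθ hσ N Φ s L]
  exact (hL₀ L hL).le

/-- **Rung 0 of (H_E)** (the second antecedent of `stub_velocityTruncationOfTails` at constant profiles,
in its own frame, with
`σ₀ = 1/2` and `N₀ = 0`). [folklore] -/
private theorem rung0_velocityTailEnergy (a θ : ℝ) (u : V3) (ha : 0 < a) (hθ : 0 < θ) :
    ∃ σ₀ : ℝ, 0 < σ₀ ∧ ∀ σ : ℝ, 0 < σ → σ < σ₀ →
    ∀ Φ : (N : ℕ) → HardSphereFlow (Torus.geometry (Fin 3)) (hsDiameter σ N) (N + 1),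
    ∀ τ : ℝ, 0 < τ → ∀ η : ℝ, 0 < η → ∃ L₀ : ℝ, ∀ L : ℝ, L₀ ≤ L → ∃ N₀ : ℕ, ∀ N : ℕ, N₀ ≤ N →
    ∀ s ∈ Icc (0 : ℝ) τ,
      ∫⁻ z, ENNReal.ofReal (tailEnergy L ((Φ N).flow s z))
        ∂(localGibbsLaw σ (fun _ => a) (fun _ => u) (fun _ => θ) N (Φ N)) ≤ ENNReal.ofReal η := by
  refine ⟨1 / 2, by norm_num, fun σ _ hσ Φ τ _ η hη => ?_⟩
  obtain ⟨L₀, hL₀⟩ := rung0_lintegral_tailEnergy_flow_le a u ha hθ hσ.le hη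
  exact ⟨L₀, fun L hL => ⟨0, fun N _ s _ => hL₀ L hL N (Φ N) s⟩⟩


/-! ## The registered stub -/

/-- **S1 at rung 0** (registered stub `stub_velocityTruncationRung0` of the line `even-rung-mean-variance`,
verbatim): for constant profiles `(a, u, θ)`, `a, θ > 0`, the velocity truncation of the even collision
statistic is tight in probability under the homogeneous Gibbs law — `η₀ = min ηK ηY`, then, profile by profile,
`velocityTruncation_of_tails_at` fed with (H_K)₀ `stub_velocityTailCollisionSumRung0` and (H_E)₀
`rung0_velocityTailEnergy`. [folklore] -/
theorem stub_velocityTruncationRung0 :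
    ∃ η₀ : ℝ, 0 < η₀ ∧ ∀ (a θ : ℝ) (u : V3), 0 < a → 0 < θ → ∃ σ₀ : ℝ, 0 < σ₀ ∧ ∀ σ : ℝ, 0 < σ → σ < σ₀ →
      ∀ Φ : (N : ℕ) → HardSphereFlow (Torus.geometry (Fin 3)) (hsDiameter σ N) (N + 1), ∀ τ : ℝ, 0 < τ →
      ∀ χ : ℝ × UnitAddTorus (Fin 3) → ℝ, Continuous χ → ∀ g : ℝ → ℝ, Continuous g → (∀ a, η₀ ≤ a →
      g a = 0) → ∀ η δ : ℝ, 0 < η → 0 < δ → ∃ r₀ : ℝ, 0 < r₀ ∧ ∀ r : ℝ, 0 < r → r < r₀ → ∃ L₀ : ℝ,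
      ∀ L : ℝ, L₀ ≤ L → ∃ N₀ : ℕ, ∀ N : ℕ, N₀ ≤ N → ∀ k l : Fin 3,
      localGibbsLaw σ (fun _ => a) (fun _ => u) (fun _ => θ) N (Φ N) {z | η < |evenStat σ N (Φ N) τ χ g
      (evenMark k l) r z - evenStat σ N (Φ N) τ χ g (evenMarkTrunc k l L) r z|} ≤ ENNReal.ofReal δ := by
  obtain ⟨ηK, hηK, HK⟩ := stub_velocityTailCollisionSumRung0
  obtain ⟨ηY, hηY, CY, hCY⟩ := exists_contactValue_bound
  refine ⟨min ηK ηY, lt_min hηK hηY, fun a θ u ha hθ => ?_⟩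
  exact velocityTruncation_of_tails_at (a₀ := fun _ => a) (θ₀ := fun _ => θ) (u₀ := fun _ => u)
    continuous_const continuous_const continuous_const (fun _ => ha) (fun _ => hθ) hηY hCY (HK a θ u ha hθ)
    (rung0_velocityTailEnergy a θ u ha hθ)

end Summit.AtomisticToContinuum.HydrodynamicLimit.Theorems.EvenStressEnskog

end
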